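import Summits.Ventures.PercRepro.SixThreePair

/-!
# PercRepro — the coloop extension of the denominator: `D(S ∪ y) ≤ D(S) + Λ(S)` for `y ∉ cl(S)` (p5, gen 7)

mine-2's `MINE2-RLS.md` §19.4′ (Lemma (T), the coloop step), in the form (L4) of p3's plan of record: if `y ∉ cl(S)`
then every plane `P` not containing `y` keeps its term `f(P, S)`, and a plane `P ∋ y` contributes to `D(S ∪ y)`
exactly when its trace `ℓ = S ∩ P` has rank `2` (then `ρ(ℓ ∪ y) = 3`), with the term `6^{|ℓ| + 1 − 3} = 6^{|ℓ| − 2}`;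
such a plane is `cl(ℓ ∪ y)`, so `P ↦ cl(ℓ) ∈ linesOf M S` is injective with `cl(ℓ) ∩ S = ℓ`, and the new terms sum to
at most `Λ(S) = Σ_{L ∈ linesOf S} 6^{|L ∩ S| − 2}`.
-/

namespace PercRepro

namespace SixThree

open Finset ThmH

variable {α : Type*} [DecidableEq α] {M : Matroid α} [M.Finite]

/-- The trace of `insert y S` on a plane not containing `y` is the trace of `S`. -/
theorem insert_inter_of_notMem {S P : Finset α} {y : α} (hy : y ∉ P) : (insert y S) ∩ P = S ∩ P := by
  ext z
  simp only [Finset.mem_inter, Finset.mem_insert]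
  constructor
  · rintro ⟨rfl | hz, hzP⟩
    · exact absurd hzP hy
    · exact ⟨hz, hzP⟩
  · rintro ⟨hz, hzP⟩
    exact ⟨Or.inr hz, hzP⟩

/-- The trace of `insert y S` on a plane containing `y` is `insert y (S ∩ P)`. -/
theorem insert_inter_of_mem {S P : Finset α} {y : α} (hy : y ∈ P) :
    (insert y S) ∩ P = insert y (S ∩ P) := by
  ext z
  simp only [Finset.mem_inter, Finset.mem_insert]
  constructor
  · rintro ⟨rfl | hz, hzP⟩
    · exact Or.inl rfl
    · exact Or.inr ⟨hz, hzP⟩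
  · rintro (rfl | ⟨hz, hzP⟩)
    · exact ⟨Or.inl rfl, hy⟩
    · exact ⟨Or.inr hz, hzP⟩

/-- **The coloop extension of the denominator** (mine-2 §19.4′, (L4)): for `y ∈ E` outside `cl(S)`,
`D(S ∪ y) ≤ D(S) + Λ(S)`. -/
theorem D_insert_le_of_notMem_closure {S : Finset α} (hS : S ⊆ gr M) {y : α} (hy : y ∈ gr M)
    (hycl : y ∉ clF M S) : D M (insert y S) ≤ D M S + Lam M S := by
  classical
  have hyE : y ∈ M.E := by rw [← coe_gr M]; exact Finset.mem_coe.2 hy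
  have hynot : ∀ B ⊆ S, y ∉ M.closure (B : Set α) := by
    intro B hB h
    apply hycl
    have h' : y ∈ M.closure (S : Set α) := M.closure_subset_closure (Finset.coe_subset.2 hB) h
    rw [← coe_clF] at h'
    exact Finset.mem_coe.1 h'
  have hyS : y ∉ S := fun h => hynot S (Finset.Subset.refl S)
    (M.mem_closure_of_mem (Finset.mem_coe.2 h) (by rw [← coe_gr M]; exact Finset.coe_subset.2 hS))
  -- the rank of a trace plus `y`
  have hrank : ∀ P : Finset α, M.eRk ((insert y (S ∩ P) : Finset α) : Set α) =
      M.eRk ((S ∩ P : Finset α) : Set α) + 1 := by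
    intro P
    rw [Finset.coe_insert]
    exact M.eRk_insert_eq_add_one ⟨hyE, hynot _ Finset.inter_subset_left⟩
  -- the per-plane term of `D(S ∪ y)`
  have hterm : ∀ P ∈ planes M, fRule M P (insert y S) =
      if y ∈ P then (if M.eRk ((S ∩ P : Finset α) : Set α) = 2 then (6 : ℚ) ^ ((S ∩ P).card - 2) else 0)
      else fRule M P S := by
    intro P _
    by_cases hyP : y ∈ P
    · rw [if_pos hyP]
      unfold fRule
      rw [insert_inter_of_mem hyP, hrank P, Finset.card_insert_of_notMem (fun h => hyS (Finset.mem_inter.1 h).1)]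
      obtain ⟨k, hk, -⟩ := eRk_eq_nat M (S ∩ P)
      rw [hk]
      by_cases h2 : k = 2
      · subst h2
        rw [if_pos (by norm_num), if_pos (by norm_num)]
        have : (S ∩ P).card + 1 - 3 = (S ∩ P).card - 2 := by omega
        rw [this]
      · have hne1 : ¬ ((k : ℕ∞) + 1 = 3) := by
          intro h
          have h' : ((k + 1 : ℕ) : ℕ∞) = ((3 : ℕ) : ℕ∞) := by exact_mod_cast h
          have := ENat.coe_inj.1 h'
          omega
        have hne2 : ¬ ((k : ℕ∞) = 2) := by
          intro h
          exact h2 (by exact_mod_cast h)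
        rw [if_neg hne1, if_neg hne2]
    · rw [if_neg hyP]
      unfold fRule
      rw [insert_inter_of_notMem hyP]
  -- the planes through `y` with a rank-2 trace
  set A := (planes M).filter (fun P => y ∈ P ∧ M.eRk ((S ∩ P : Finset α) : Set α) = 2) with hA
  have hsplit : D M (insert y S) = ∑ P ∈ (planes M).filter (fun P => ¬ y ∈ P), fRule M P S +
      ∑ P ∈ A, (6 : ℚ) ^ ((S ∩ P).card - 2) := by
    unfold D
    rw [Finset.sum_congr rfl hterm, ← Finset.sum_filter_add_sum_filter_not (planes M) (fun P => y ∈ P),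
      add_comm]
    congr 1
    · apply Finset.sum_congr rfl
      intro P hP
      rw [if_neg (Finset.mem_filter.1 hP).2]
    · rw [hA, ← Finset.filter_filter, Finset.sum_filter (fun P => M.eRk ((S ∩ P : Finset α) : Set α) = 2)]
      apply Finset.sum_congr rfl
      intro P hP
      rw [if_pos (Finset.mem_filter.1 hP).2]
  -- the old planes contribute at most `D(S)`
  have h1 : ∑ P ∈ (planes M).filter (fun P => ¬ y ∈ P), fRule M P S ≤ D M S := by
    unfold D
    apply Finset.sum_le_sum_of_subset_of_nonneg (Finset.filter_subset _ _)
    intro P _ _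
    exact fRule_nonneg M P S
  -- the new planes inject into the lines of `M|S`
  have hline : ∀ P ∈ A, clF M (S ∩ P) ∈ linesOf M S ∧ clF M (S ∩ P) ∩ S = S ∩ P := by
    intro P hP
    rw [hA, Finset.mem_filter] at hP
    obtain ⟨hP, hyP, h2⟩ := hP
    obtain ⟨hL, hsub⟩ := clF_mem_lines (Finset.inter_subset_left.trans hS) h2
    have hflat : M.IsFlat (P : Set α) := (mem_planes.1 hP).2.1
    have hclP : clF M (S ∩ P) ⊆ P := by
      rw [← Finset.coe_subset, coe_clF]
      exact (M.closure_subset_closure (Finset.coe_subset.2 Finset.inter_subset_right)).trans hflat.closure.subset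
    have heq : clF M (S ∩ P) ∩ S = S ∩ P := by
      ext z
      rw [Finset.mem_inter, Finset.mem_inter]
      constructor
      · rintro ⟨hz, hzS⟩
        exact ⟨hzS, hclP hz⟩
      · intro hz
        exact ⟨hsub (Finset.mem_inter.2 hz), hz.1⟩
    refine ⟨?_, heq⟩
    unfold linesOf
    rw [Finset.mem_filter, heq]
    refine ⟨hL, ?_⟩
    have h := M.eRk_le_encard ((S ∩ P : Finset α) : Set α)
    rw [h2, Set.encard_coe_eq_coe_finsetCard] at h
    exact_mod_cast h
  have hinj : Set.InjOn (fun P => clF M (S ∩ P)) (A : Set (Finset α)) := by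
    intro P hP P' hP' h
    simp only at h
    rw [Finset.mem_coe, hA, Finset.mem_filter] at hP hP'
    obtain ⟨hP, hyP, h2⟩ := hP
    obtain ⟨hP', hyP', h2'⟩ := hP'
    have hr3 : M.eRk ((insert y (S ∩ P) : Finset α) : Set α) = 3 := by rw [hrank, h2]; rfl
    have hr3' : M.eRk ((insert y (S ∩ P') : Finset α) : Set α) = 3 := by rw [hrank, h2']; rfl
    have e1 := closure_eq_of_subset_plane hP (Finset.insert_subset hyP Finset.inter_subset_right) hr3
    have e2 := closure_eq_of_subset_plane hP' (Finset.insert_subset hyP' Finset.inter_subset_right) hr3'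
    have hcl : M.closure ((S ∩ P : Finset α) : Set α) = M.closure ((S ∩ P' : Finset α) : Set α) := by
      rw [← coe_clF, ← coe_clF, h]
    apply Finset.coe_injective
    rw [← e1, ← e2, Finset.coe_insert, Finset.coe_insert, ← M.closure_insert_closure_eq_closure_insert, hcl,
      M.closure_insert_closure_eq_closure_insert]
  have h2 : ∑ P ∈ A, (6 : ℚ) ^ ((S ∩ P).card - 2) ≤ Lam M S := by
    unfold Lam
    calc ∑ P ∈ A, (6 : ℚ) ^ ((S ∩ P).card - 2)
        = ∑ P ∈ A, (6 : ℚ) ^ ((clF M (S ∩ P) ∩ S).card - 2) := by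
          apply Finset.sum_congr rfl
          intro P hP
          rw [(hline P hP).2]
      _ = ∑ L ∈ A.image (fun P => clF M (S ∩ P)), (6 : ℚ) ^ ((L ∩ S).card - 2) := by
          rw [Finset.sum_image hinj]
      _ ≤ ∑ L ∈ linesOf M S, (6 : ℚ) ^ ((L ∩ S).card - 2) := by
          apply Finset.sum_le_sum_of_subset_of_nonneg
          · intro L hL
            rw [Finset.mem_image] at hL
            obtain ⟨P, hP, rfl⟩ := hL
            exact (hline P hP).1
          · intro L _ _
            positivity
  rw [hsplit]
  exact add_le_add h1 h2

end SixThree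

end PercRepro
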